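import Literature.AnabelianGeometry.AbsoluteAnabelian.HolomorphicEllipticCuspidalizationUniformizationReduction
import Literature.Geometry.Kaehler.RiemannSurfaceGenusOneHolomorphicForm
import Literature.Geometry.Kaehler.RiemannSurfaceCompactAlgebraicCurve
import HarnessLib

/-!
# [AbsTopIII] Cor. 2.7 (c), unconditional: the genus-one uniformization input is a theorem of the tree

Layer `Literature/AnabelianGeometry/AbsoluteAnabelian`, PROOF-ONLY closer of
`HolomorphicEllipticCuspidalizationUniformizationReduction` (which derives the named fact
`HolomorphicEllipticCuspidalization.GenusOneUniformization` — «a compact connected Riemann surface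
homeomorphic to a torus is biholomorphic to a complex torus `ℂ/Λ`» — and the node's named fact
`TorsionPointsDenseUniqueGroupLaw` ([AbsTopIII] Cor. 2.7 (c)) from the hypothesis `hA`: every compact
connected Riemann surface homeomorphic to a torus carries a holomorphic `1`-form with no zeros).  The
hypothesis `hA` is now PROVED in the tree
(`RiemannSurfaceGenusOneHolomorphicForm`:
`MeromorphicOneForm.exists_isHolomorphic_forall_meromorphicOrderAt_eq_zero_of_isAlgebraicCurve` — Riemann–Roch,
Serre duality, the period bound, the normal form of `1`-forms — over the class `IsAlgebraicCurve`, which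
`RiemannSurfaceCompactAlgebraicCurve.isAlgebraicCurve_of_compactSpace` (Miranda's Theorem VI.1.9)
supplies for every compact connected Riemann surface), so both named facts hold unconditionally.

S. Mochizuki, *Topics in Absolute Anabelian Geometry III*, Cor. 2.7 (c) (kurims p. 59), as printed:
«the elliptic curve determined by» the once-punctured elliptic curve underlying `𝔼^{top}` — print
ASSUMES an elliptic curve; the typed hypothesis `IsPuncturedEllipticCurve` is conformal-topological
(compact Riemann surface homeomorphic to a torus, punctured once), which is why the classical
uniformization of genus one enters (GAP-LEDGER G-L4t12g4-1 of the abc-iut cell, closed here).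

* **`genusOneUniformization_holds : GenusOneUniformization`**;
* **`torsionPointsDenseUniqueGroupLaw_holds : TorsionPointsDenseUniqueGroupLaw`** ([AbsTopIII] Cor. 2.7
  (c): the cuspidal torsion points are dense and determine the group law);
* `puncturedEllipticCurveModel_holds` (sub-node (c).4 unconditional) and
  `dense_cuspidalTorsionPoints_of_isPuncturedEllipticCurve` (the density clause alone).

Everything is proved; no definitions, no named facts. Classical complex analysis + the tree's
Cor. 2.7 (c) reduction; OUR kernel check of a printed claim of a refereed paper — nothing here bears on
[IUTchIII] Cor. 3.12.

## References

* S. Mochizuki, *Topics in Absolute Anabelian Geometry III: Global Reconstruction Algorithms*, J. Math.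
  Sci. Univ. Tokyo 22 (2015), Corollary 2.7 (c). [MochizukiAbsTopIII2015]
* H. M. Farkas, I. Kra, *Riemann Surfaces*, 2nd ed., GTM 71, Springer (1992), III.6 (introduction),
  III.6.4 Corollary 1. [FarkasKra1992]
-/

noncomputable section

namespace Literature.AnabelianGeometry.AbsoluteAnabelian

open scoped _root_.Manifold _root_.ContDiff
open Literature.Geometry.Kaehler
open Literature.Geometry.Kaehler.RiemannSurface

namespace HolomorphicEllipticCuspidalization

/-- **`GenusOneUniformization` holds**: a compact connected Riemann surface homeomorphic to a torus is
biholomorphic to a complex torus `ComplexTorus Φ = ℂ/Φ(ℤ²)` (the classical base of [AbsTopIII]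
Cor. 2.7 (c); abc-iut GAP G-L4t12g4-1). [cite: FarkasKra1992, III.6 (introduction), III.6.4 Corollary 1] -/
theorem genusOneUniformization_holds :
    Literature.AnabelianGeometry.AbsoluteAnabelian.HolomorphicEllipticCuspidalization.GenusOneUniformization :=
  genusOneUniformization_of_forall_exists_oneForm fun T _ _ _ _ _ _ hT ↦ by
    obtain ⟨e₀⟩ := hT
    haveI : IsAlgebraicCurve T := isAlgebraicCurve_of_compactSpace T
    exact MeromorphicOneForm.exists_isHolomorphic_forall_meromorphicOrderAt_eq_zero_of_isAlgebraicCurve e₀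

/-- `GenusOneUniformization` — `_holds` alias of `genusOneUniformization_holds` above under the fact's exact name (appended
2026-08-28, D-0026 bookkeeping: the proof term is the existing theorem of this file; no statement,
definition or attribute is edited; no new named fact; the ledger's debt table listed the fact
unproved). [cite: FarkasKra1992, III.6 (introduction), III.6.4 Corollary 1] -/
theorem _root_.Literature.AnabelianGeometry.AbsoluteAnabelian.HolomorphicEllipticCuspidalization.GenusOneUniformization_holds :
    Literature.AnabelianGeometry.AbsoluteAnabelian.HolomorphicEllipticCuspidalization.GenusOneUniformization :=
  _root_.Literature.AnabelianGeometry.AbsoluteAnabelian.HolomorphicEllipticCuspidalization.genusOneUniformization_holds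

/-- **[AbsTopIII] Cor. 2.7 (c) holds unconditionally**: for the Aut-holomorphic space of a
once-punctured elliptic curve (typed: a compact Riemann surface homeomorphic to a torus, punctured once),
the cuspidal torsion points are dense and any two topological abelian group structures on the one-point
compactification agreeing on them coincide — the tree's reduction
`torsionPointsDenseUniqueGroupLaw_of_genusOneUniformization` fed with `genusOneUniformization_holds`.
[cite: MochizukiAbsTopIII2015, Corollary 2.7 (c) p.59] -/
theorem torsionPointsDenseUniqueGroupLaw_holds :
    Literature.AnabelianGeometry.AbsoluteAnabelian.TorsionPointsDenseUniqueGroupLaw :=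
  torsionPointsDenseUniqueGroupLaw_of_genusOneUniformization genusOneUniformization_holds

/-- `TorsionPointsDenseUniqueGroupLaw` — `_holds` alias of `torsionPointsDenseUniqueGroupLaw_holds` above under the fact's exact name (appended
2026-08-28, D-0026 bookkeeping: the proof term is the existing theorem of this file; no statement,
definition or attribute is edited; no new named fact; the ledger's debt table listed the fact
unproved). [cite: MochizukiAbsTopIII2015, Corollary 2.7 (c) p.59] -/
theorem _root_.Literature.AnabelianGeometry.AbsoluteAnabelian.TorsionPointsDenseUniqueGroupLaw_holds :
    Literature.AnabelianGeometry.AbsoluteAnabelian.TorsionPointsDenseUniqueGroupLaw :=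
  _root_.Literature.AnabelianGeometry.AbsoluteAnabelian.HolomorphicEllipticCuspidalization.torsionPointsDenseUniqueGroupLaw_holds

/-- **Sub-node (c).4 unconditional: every punctured elliptic curve in the typed sense is biholomorphic to
a model punctured torus `ℂ/Φ(ℤ²) ∖ {0}`** (`PuncturedEllipticCurveModel`), from
`puncturedEllipticCurveModel_of_genusOneUniformization` and `genusOneUniformization_holds`.
[cite: MochizukiAbsTopIII2015, Corollary 2.7 (c) p.59] -/
theorem puncturedEllipticCurveModel_holds :
    Literature.AnabelianGeometry.AbsoluteAnabelian.HolomorphicEllipticCuspidalization.PuncturedEllipticCurveModel :=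
  puncturedEllipticCurveModel_of_genusOneUniformization genusOneUniformization_holds

/-- `PuncturedEllipticCurveModel` — `_holds` alias of `puncturedEllipticCurveModel_holds` above under the fact's exact name (appended
2026-08-28, D-0026 bookkeeping: the proof term is the existing theorem of this file; no statement,
definition or attribute is edited; no new named fact; the ledger's debt table listed the fact
unproved). [cite: MochizukiAbsTopIII2015, Corollary 2.7 (c) p.59] -/
theorem _root_.Literature.AnabelianGeometry.AbsoluteAnabelian.HolomorphicEllipticCuspidalization.PuncturedEllipticCurveModel_holds :
    Literature.AnabelianGeometry.AbsoluteAnabelian.HolomorphicEllipticCuspidalization.PuncturedEllipticCurveModel :=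
  _root_.Literature.AnabelianGeometry.AbsoluteAnabelian.HolomorphicEllipticCuspidalization.puncturedEllipticCurveModel_holds

/-- **The density clause of [AbsTopIII] Cor. 2.7 (c), unconditional**: for every punctured elliptic curve
`E` in the typed sense the cuspidal torsion points are dense in `E` («since the torsion points of (b) are
dense in `𝔼^top`»). [cite: MochizukiAbsTopIII2015, Corollary 2.7 (c) p.59] -/
theorem dense_cuspidalTorsionPoints_of_isPuncturedEllipticCurve
    (E : Type) [TopologicalSpace E] [T2Space E] [ChartedSpace ℂ E] [IsManifold 𝓘(ℂ, ℂ) ω E]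
    (hE : TorsionPointsDenseUniqueGroupLaw.IsPuncturedEllipticCurve E) :
    Dense (cuspidalTorsionPoints E) :=
  dense_cuspidalTorsionPoints_of_genusOneUniformization genusOneUniformization_holds E hE

end HolomorphicEllipticCuspidalization

end Literature.AnabelianGeometry.AbsoluteAnabelian

end
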